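import Literature.NumberTheory.CubicFields.OrbitFiniteness
import Literature.NumberTheory.CubicFields.CubicFieldCountByDisc
import HarnessLib

/-!
# The Davenport–Heilbronn uniformity estimate: cubic rings with `q² ∣ Disc` (BTT 2023, Prop. 4.5) — named fact

Topic `Literature/NumberTheory/CubicFields`; vocabulary from `OrbitFiniteness.lean` (`classNumber D =
h(D)`, the number of `GL₂(ℤ)`-orbits of integral binary cubic forms of discriminant `D`, BTT (22)) and
`CubicFieldCountByDisc.lean` (`discWindow s X`, the integers `D` with `0 < s·D < X`).

Bhargava–Taniguchi–Thorne 2023, §4.2 "Uniformity/tail estimates": "Our basic uniformity/tail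
estimate is a variation of [DH] and [BBP], which bounds the number of cubic rings having absolute
discriminant less than `X` and divisible by `q²`, where `q` is squarefree; the exact statement can be
found as [BBP] (see also [TT_rc]).
**Proposition 4.5.** For each squarefree integer `q`, the number of cubic rings `R` with
`q² ∣ Disc(R)` and `0 < ±Disc(R) < X` is `≪ 6^{ω(q)} X/q²`. Here (and elsewhere), `ω(q)` is the number
of prime divisors of `q`."

POPULATION. "Cubic rings" are ALL cubic rings (commutative rings free of rank `3` over `ℤ`) up to
isomorphism, with no irreducibility, maximality or primitivity restriction (BTT §4.1: "the sum is over
all isomorphism classes of cubic rings"); by the Levi–Delone–Faddeev correspondence (BTT Thm 2.1; tree: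
`DeloneFaddeevCorrespondence.lean`, `existsUnique_gl2zOrbit_of_finrank_eq_three`,
`RingOfForm.nonempty_ringEquiv_iff`) the isomorphism classes of cubic rings of discriminant `D` are
exactly the `GL₂(ℤ)`-orbits of integral binary cubic forms of discriminant `D`, `classNumber D` of them
(`orbitsOfDisc D`; finite for `D ≠ 0`). So "the number of cubic rings `R` with `q² ∣ Disc(R)` and
`0 < s·Disc(R) < X`" (`s = ±1`) is `Σ_{D ∈ discWindow s X, q² ∣ D} classNumber D`, and the printed
`≪` (implied constant absolute: independent of `q` and `X`) is rendered as one real constant `C` valid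
for all squarefree `q ≥ 1`, both signs and all `X ∈ ℕ` (restricting the real parameter `X` of print to
natural numbers is weaker than print).

* `btt_uniformity_sqDvd` — the named fact (a `def … : Prop`, CONVENTIONS §4; not proved here).

NOT here: the proof ([BBP] Belabas–Bhargava–Pomerance 2010 via the Davenport–Heilbronn
correspondence and counting in fundamental domains), the companion Prop. 4.6 (`3^{ω(q)}` for rings
non-maximal at `q`) and Prop. 4.7 (cubefree `q ∣ Disc`). Consumer: crux stmt-ABC-1975
(`TwistAmplification.SharpModerateLaw`), stub `stub_fieldSum` (the field sum
`Σ_{0<|D|≤N} h_max(D)/rad D ≪_ε N^ε`).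

## References

* M. Bhargava, T. Taniguchi, F. Thorne, *Improved error estimates for the Davenport–Heilbronn
  theorems*, Math. Ann. 389 (2024) = arXiv:2107.12819, §4.2, Proposition 4.5 [BhargavaTaniguchiThorne2023].
* K. Belabas, M. Bhargava, C. Pomerance, *Error estimates for the Davenport–Heilbronn theorems*,
  Duke Math. J. 153 (2010) 173–210 [BelabasBhargavaPomerance2010].
* H. Davenport, H. Heilbronn, *On the density of discriminants of cubic fields. II*, Proc. Roy.
  Soc. London A 322 (1971) 405–420 [DavenportHeilbronn1971].
-/

noncomputable section

namespace Literature.NumberTheory.CubicFields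

/-- **Bhargava–Taniguchi–Thorne 2023, Proposition 4.5** (Davenport–Heilbronn / Belabas–Bhargava–Pomerance
uniformity estimate), as printed: "For each squarefree integer `q`, the number of cubic rings `R` with
`q² ∣ Disc(R)` and `0 < ±Disc(R) < X` is `≪ 6^{ω(q)} X/q²`", where `ω(q)` is the number of prime
divisors of `q` (`q.primeFactors.card`) and the implied constant is absolute. Population: ALL cubic
rings up to isomorphism = all `GL₂(ℤ)`-orbits of integral binary cubic forms (Levi–Delone–Faddeev,
BTT Thm 2.1, `DeloneFaddeevCorrespondence.lean`), so the number of cubic rings of discriminant `D` is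
`classNumber D` (`OrbitFiniteness.lean`, BTT (22)) and the count in the window `0 < s·D < X`
(`discWindow s X`, `s = ±1`) with `q² ∣ D` is `Σ_{D ∈ discWindow s X, q² ∣ D} classNumber D`; one
constant `C` serves all squarefree `q`, both signs and all `X ∈ ℕ`.
[cite: BhargavaTaniguchiThorne2023, Proposition 4.5] -/
def btt_uniformity_sqDvd : Prop :=
  ∃ C : ℝ, ∀ q : ℕ, Squarefree q → ∀ s : ℤ, (s = 1 ∨ s = -1) → ∀ X : ℕ,
    (((∑ D ∈ (discWindow s X).filter (fun D => (q : ℤ) ^ 2 ∣ D), classNumber D : ℕ) : ℝ))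
      ≤ C * 6 ^ q.primeFactors.card * X / (q : ℝ) ^ 2

/-- Sanity of the spelling: the summation range is a genuine finite set of integers (e.g. for `q = 2`,
`s = 1`, `X = 9` it is `{4, 8}`), so the left side is a natural number and the fact is not vacuous. [folklore] -/
example : (discWindow 1 9).filter (fun D => ((2 : ℕ) : ℤ) ^ 2 ∣ D) = {4, 8} := by
  decide

end Literature.NumberTheory.CubicFields

end
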